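import Summits.BirchSwinnertonDyer.BirchSwinnertonDyer.Theorems.CMKolyvaginAtInertTwoPairSupplyCompositeAtTwo
import Summits.BirchSwinnertonDyer.BirchSwinnertonDyer.Theses.CMKolyvaginAtInertTwo
import Summits.BirchSwinnertonDyer.BirchSwinnertonDyer.Theorems.GenusKolyvaginAtTwoPowDvdShaCardAtTwoRTLadderFrameOneSided
import HarnessLib

/-!
# Route `CMKolyvaginAtInertTwo`, crux `CMKolyvaginExactAtInertTwo` (stmt-BirchSwinnertonDyer-24277) —
# Ш-VALUED LADDERS FORCE `#Ш(E_K)(2) ≥ 2^{2M₀+Σ−1}`: the crux is INCOMPATIBLE with loss-free ladders unless `Σ ≤ 1`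

Seat `bsd-line-cmk2-p1` g20 (cell `bsd-print-cf2`), `--supports stmt-BirchSwinnertonDyer-24277` (helper;
closes nothing).  THEOREMS ONLY (no definition, no named fact, no `sorry`).  BSD is NOT proved by this.

The kernel form of memo `Cruxes/CMExactDescentAtTwo/MEMO-genus-triviality.md` §6.2, with the one input that
is not yet threaded through the tree DISPLAYED as a hypothesis: McCallum's two ladders (antitone `M`, `M 0 = M₀`,
`M (2T) = 0`; at rung `m` families of `2m+2` independent classes of orders `2^{M(2m)−M(2m+1)}` /
`2^{M(2m+1)−M(2m+2)}`) taken WITH VALUES IN `Ш(W/ℚ)` and `Ш(W^{(d_K)}/ℚ)` themselves — which is what the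
(KS) ladders of a level-4 Gross witness become after one spare level (Dokchitser–Dokchitser's degree trick
`torsionH1ZSMul_two_mem_selmerLocalKer_of_resTorsion_mem`, both signs; this seat's
`exists_selmer_resTorsion_eq_kolyvaginClass_two_of_sign_one` on the `W`-side).  Then:

* `two_pow_mul_two_pow_sum_defect_le_of_shaValuedLadders` — **`2^{2M₀} · 2^{Σ} ≤ #Ш(E_K)(2) · 2`**
  (gk2-p4's defect-rank frame `two_mul_le_padicValNat_add_of_ladders_of_sha_le` with `R₊ = Ш(W)`,
  `R₋ = Ш(W^{(d_K)})`, both defect budgets `0`; then g15's count identity), modulo GZ / GZK / modularity / Milne;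
* `sum_defect_le_one_of_cmKolyvaginExact_of_shaValuedLadders` — **with the crux's conclusion `#Ш(E_K)(2) = 2^{2M₀}`
  (route Prop `CMKolyvaginExactAtInertTwo` applied to its own frame and certificate) this forces `Σ ≤ 1`**:
  on a Heegner field with `Σ ≥ 3` the crux EXCLUDES Ш-valued ladders of full length `M₀`, hence (memo §6.2)
  excludes a level-4 Gross witness — the W-UP engine of the `Σ = 1` proof cannot exist for composite `d_K`.

References: [McCallumLMS1991] §5 Prop. 5.2, Thm. 5.4, Cor. 5.6; [Kramer1981] Prop. 3; [Milne1972] Thm. 1;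
[DokchitserDokchitserAnnals2010] Lemma 4.14 (proof); [SilvermanAEC2009] X.4.14.
-/

set_option autoImplicit false
-- the Theorems namespace of this sub repeats the summit name by design (D-0017 nested layout)
set_option linter.dupNamespace false

noncomputable section

open scoped Classical

namespace Summit.BirchSwinnertonDyer.BirchSwinnertonDyer.Theorems.KolyvaginGenusTwo

open WeierstrassCurve NumberField IsDedekindDomain Field
open Literature.NumberTheory.EllipticCurves Literature.NumberTheory.GaloisRepresentations
open Literature.NumberTheory.EllipticCurves.ModularForms Literature.NumberTheory.EllipticCurves.RingClassField
open Summit.BirchSwinnertonDyer.BirchSwinnertonDyer.Theses.CMKolyvaginAtInertTwo (CMKolyvaginExactAtInertTwo)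
open Summit.BirchSwinnertonDyer.BirchSwinnertonDyer.Theorems.GenusExact

variable (W : WeierstrassCurve ℚ) {K : Type} [Field K] [NumberField K]

/-- **Ш-VALUED LADDERS OF LENGTH `M₀` FORCE `2^{2M₀}·2^{Σ} ≤ #Ш(E_K)(2)·2`** (every odd `d_K`; H₂ frame with
`y_K` of infinite order; modulo GZ / GZK / modularity / Milne).  The ladders are hypotheses (`hfam`, `hfam'`):
families IN `Ш(W/ℚ)` and IN `Ш(W^{(d_K)}/ℚ)`.  Proof: gk2-p4's defect-rank frame with zero budgets gives
`2M₀ ≤ ord₂ #Ш(W)(2) + ord₂ #Ш(W^{(d_K)})(2)`; g15's count identity converts the right side.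
[cite: McCallumLMS1991, §5 Thm. 5.4] [cite: Kramer1981, Prop. 3] [cite: Milne1972ArithmeticAV, Thm. 1] -/
theorem two_pow_mul_two_pow_sum_defect_le_of_shaValuedLadders
    (hGZ : ∀ (N : ℕ) [NeZero N] (W : WeierstrassCurve ℚ) (K : Type) [Field K] [NumberField K], gross_zagier N W K)
    (hGZK : rank_eq_analyticRank_of_analyticRank_le_one) (hmod : hasEntireLFunction_rat)
    (hMilneC : Milne1972.bsdQuotient_baseChange_quadratic_anyModel)
    [W.IsElliptic] [W.IsGloballyMinimal] [NeZero (W.conductorNorm ℤ)]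
    (hCM : W.HasCM) (hin : Literature.NumberTheory.EllipticCurves.Rank1Residual.CMInert W 2)
    (hρ : W.HasSurjectiveModNGaloisRep 2) (hK : IsImaginaryQuadratic K)
    (hoddK : Odd (NumberField.discr K)) (hH : SatisfiesHeegnerHypothesis (W.conductorNorm ℤ) K)
    (Dt : ModularParametrizationData W (W.conductorNorm ℤ)) (β : ℤ) (ιK : K →+* ℂ) (d₁ : KolyvaginHeegnerData Dt β ιK 1)
    (hy : ¬ IsOfFinAddOrder d₁.derivedPoint)
    [(W.quadraticTwist (NumberField.discr K : ℚ)).IsElliptic]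
    (M₀ T : ℕ) (M : ℕ → ℕ) (hM : ∀ j, M (j + 1) ≤ M j) (hM0 : M 0 = M₀) (hMT : M (2 * T) = 0)
    (hfam : ∀ m < T, ∃ x : Fin (2 * m + 2) → W.galH1, (∀ i, x i ∈ W.sha) ∧
      (∀ i, addOrderOf (x i) = 2 ^ (M (2 * m) - M (2 * m + 1))) ∧
      ∀ c : Fin (2 * m + 2) → ℤ, ∑ i, c i • x i = 0 → ∀ i, ((2 ^ (M (2 * m) - M (2 * m + 1)) : ℕ) : ℤ) ∣ c i)
    (hfam' : ∀ m < T, ∃ x : Fin (2 * m + 2) → (W.quadraticTwist (NumberField.discr K : ℚ)).galH1,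
      (∀ i, x i ∈ (W.quadraticTwist (NumberField.discr K : ℚ)).sha) ∧
      (∀ i, addOrderOf (x i) = 2 ^ (M (2 * m + 1) - M (2 * m + 2))) ∧
      ∀ c : Fin (2 * m + 2) → ℤ, ∑ i, c i • x i = 0 → ∀ i, ((2 ^ (M (2 * m + 1) - M (2 * m + 2)) : ℕ) : ℤ) ∣ c i) :
    2 ^ (2 * M₀) * 2 ^ ∑ q ∈ (NumberField.discr K).natAbs.primeFactors,
        ((if jacobiSym W.Δ.num q = -1 then 1 else 0) +
          (if jacobiSym W.Δ.num q = 1 ∧ Even (W.frobeniusTrace q) then 2 else 0)) ≤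
      Nat.card (AddCommGroup.primaryComponent (W.baseChange K).sha 2) * 2 := by
  -- finiteness of the two `ℚ`-side Ш (GZ / GZK / modularity)
  obtain ⟨-, hfinW, hfinD⟩ := ShaCountTwo.rank_add_eq_one_and_finite_sha_of_heegnerData_of_facts hGZ hGZK hmod W K hK hH
    Dt β ιK d₁ hy (W.quadraticTwist (NumberField.discr K : ℚ)) ⟨1, one_smul _ _⟩
  haveI := hfinW
  haveI := hfinD
  have hg : 0 < Nat.card (AddCommGroup.primaryComponent W.sha 2) := Nat.card_pos
  have hg' : 0 < Nat.card (AddCommGroup.primaryComponent (W.quadraticTwist (NumberField.discr K : ℚ)).sha 2) := Nat.card_pos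
  -- the defect-rank frame with zero budgets
  have hframe := PlusDescent.two_mul_le_padicValNat_add_of_ladders_of_sha_le W (W.quadraticTwist (NumberField.discr K : ℚ))
    (β₁ := 0) (β₂ := 0) W.sha le_rfl (by rw [AddSubgroup.relIndex_self]; exact one_ne_zero)
    (by rw [AddSubgroup.relIndex_self, pow_zero])
    (W.quadraticTwist (NumberField.discr K : ℚ)).sha le_rfl (by rw [AddSubgroup.relIndex_self]; exact one_ne_zero)
    (by rw [AddSubgroup.relIndex_self, pow_zero]) hg hg' T M hM hMT hfam hfam'
  rw [hM0, Nat.zero_div, mul_zero, add_zero, add_zero] at hframe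
  set a := padicValNat 2 (Nat.card (AddCommGroup.primaryComponent W.sha 2)) with ha
  set b := padicValNat 2 (Nat.card (AddCommGroup.primaryComponent (W.quadraticTwist (NumberField.discr K : ℚ)).sha 2)) with hb
  have hA : 2 ^ a ≤ Nat.card (AddCommGroup.primaryComponent W.sha 2) := Nat.le_of_dvd hg pow_padicValNat_dvd
  have hB : 2 ^ b ≤ Nat.card (AddCommGroup.primaryComponent (W.quadraticTwist (NumberField.discr K : ℚ)).sha 2) :=
    Nat.le_of_dvd hg' pow_padicValNat_dvd
  have hpair : 2 ^ (2 * M₀) ≤ Nat.card (AddCommGroup.primaryComponent W.sha 2) *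
      Nat.card (AddCommGroup.primaryComponent (W.quadraticTwist (NumberField.discr K : ℚ)).sha 2) :=
    calc 2 ^ (2 * M₀) ≤ 2 ^ (a + b) := Nat.pow_le_pow_right (by norm_num) hframe
      _ = 2 ^ a * 2 ^ b := pow_add 2 a b
      _ ≤ _ := Nat.mul_le_mul hA hB
  -- the count identity
  obtain ⟨-, hid⟩ := ShaCountTwo.card_primaryComponent_sha_two_baseChange_mul_two_eq_of_heegnerData_of_facts hGZ hGZK hmod
    hMilneC W hρ K hK hoddK hH Dt β ιK d₁ hy
  have hΔ : ¬ 0 < W.Δ := not_lt.mpr (KolyvaginEigenTwo.Δ_neg_of_cmInert_two W hCM hin hρ).le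
  rw [hid, if_neg hΔ, one_mul]
  exact Nat.mul_le_mul_right _ hpair

/-- **THE CRUX EXCLUDES Ш-VALUED LADDERS UNLESS `Σ ≤ 1`.**  On a frame of 24277's own hypotheses with a primitive
certificate, the route Prop gives `#Ш(E_K)(2) = 2^{2M₀}`; if McCallum's two ladders of length `M₀` exist WITH VALUES
IN `Ш(W/ℚ)`, `Ш(W^{(d_K)}/ℚ)` (as a level-4 Gross witness would provide through Dokchitser–Dokchitser's degree
trick, memo §6.2), then `2^{2M₀}·2^{Σ} ≤ 2^{2M₀}·2`, i.e. `Σ ≤ 1`.  Conditional on the crux (`hX`), the four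
prints, and the displayed ladders; closes nothing. [cite: McCallumLMS1991, §5 Thm. 5.4, Cor. 5.6]
[cite: DokchitserDokchitserAnnals2010, Lemma 4.14 (proof)] [cite: Kramer1981, Prop. 3] -/
theorem sum_defect_le_one_of_cmKolyvaginExact_of_shaValuedLadders (hX : CMKolyvaginExactAtInertTwo)
    (hGZ : ∀ (N : ℕ) [NeZero N] (W : WeierstrassCurve ℚ) (K : Type) [Field K] [NumberField K], gross_zagier N W K)
    (hGZK : rank_eq_analyticRank_of_analyticRank_le_one) (hmod : hasEntireLFunction_rat)
    (hMilneC : Milne1972.bsdQuotient_baseChange_quadratic_anyModel)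
    [W.IsElliptic] [W.IsGloballyMinimal] [NeZero (W.conductorNorm ℤ)]
    (hCM : W.HasCM) (hin : Literature.NumberTheory.EllipticCurves.Rank1Residual.CMInert W 2)
    (hρ : W.HasSurjectiveModNGaloisRep 2) (hT : Odd W.tamagawaProduct) (hK : IsImaginaryQuadratic K)
    (hoddK : Odd (NumberField.discr K)) (h3 : NumberField.discr K ≠ -3)
    (hH : SatisfiesHeegnerHypothesis (W.conductorNorm ℤ) K)
    (hns₁ : ¬ IsSquare ((NumberField.discr K : ℚ) * -|W.Δ|)) (hns₂ : ¬ IsSquare ((NumberField.discr K : ℚ) * (-(2 * |W.Δ|))))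
    (Dt : ModularParametrizationData W (W.conductorNorm ℤ)) (β : ℤ) (ιK : K →+* ℂ) (d₁ : KolyvaginHeegnerData Dt β ιK 1)
    (hy : ¬ IsOfFinAddOrder d₁.derivedPoint) (M₀ : ℕ)
    (hdiv : ∃ Q : (W.baseChange (ringClassField K ιK 1)).toAffine.Point, ((2 ^ M₀ : ℕ) : ℤ) • Q = d₁.derivedPoint)
    (hndiv : ¬ ∃ Q : (W.baseChange (ringClassField K ιK 1)).toAffine.Point, ((2 ^ (M₀ + 1) : ℕ) : ℤ) • Q = d₁.derivedPoint)
    {n : ℕ} (d : KolyvaginHeegnerData Dt β ιK n) (hn : Squarefree n)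
    (hKoly : ∀ ℓ ∈ n.primeFactors, Zhang2014.IsKolyvaginPrime (W.conductorNorm ℤ) W K 2 ℓ ∧
      Literature.NumberTheory.EllipticCurves.Rank1Residual.CMInert W ℓ)
    (hPn : ¬ ∃ Q : (W.baseChange (ringClassField K ιK n)).toAffine.Point, (2 : ℤ) • Q = d.derivedPoint)
    [(W.quadraticTwist (NumberField.discr K : ℚ)).IsElliptic]
    (T : ℕ) (M : ℕ → ℕ) (hM : ∀ j, M (j + 1) ≤ M j) (hM0 : M 0 = M₀) (hMT : M (2 * T) = 0)
    (hfam : ∀ m < T, ∃ x : Fin (2 * m + 2) → W.galH1, (∀ i, x i ∈ W.sha) ∧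
      (∀ i, addOrderOf (x i) = 2 ^ (M (2 * m) - M (2 * m + 1))) ∧
      ∀ c : Fin (2 * m + 2) → ℤ, ∑ i, c i • x i = 0 → ∀ i, ((2 ^ (M (2 * m) - M (2 * m + 1)) : ℕ) : ℤ) ∣ c i)
    (hfam' : ∀ m < T, ∃ x : Fin (2 * m + 2) → (W.quadraticTwist (NumberField.discr K : ℚ)).galH1,
      (∀ i, x i ∈ (W.quadraticTwist (NumberField.discr K : ℚ)).sha) ∧
      (∀ i, addOrderOf (x i) = 2 ^ (M (2 * m + 1) - M (2 * m + 2))) ∧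
      ∀ c : Fin (2 * m + 2) → ℤ, ∑ i, c i • x i = 0 → ∀ i, ((2 ^ (M (2 * m + 1) - M (2 * m + 2)) : ℕ) : ℤ) ∣ c i) :
    ∑ q ∈ (NumberField.discr K).natAbs.primeFactors,
        ((if jacobiSym W.Δ.num q = -1 then 1 else 0) +
          (if jacobiSym W.Δ.num q = 1 ∧ Even (W.frobeniusTrace q) then 2 else 0)) ≤ 1 := by
  have hex := hX W hCM hin hρ hT K hK hoddK h3 hH hns₁ hns₂ Dt β ιK d₁ hy M₀ hdiv hndiv n d hn hKoly hPn
  have hle := two_pow_mul_two_pow_sum_defect_le_of_shaValuedLadders W hGZ hGZK hmod hMilneC hCM hin hρ hK hoddK hH Dt β ιK d₁ hy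
    M₀ T M hM hM0 hMT hfam hfam'
  rw [hex] at hle
  have h2 : 0 < 2 ^ (2 * M₀) := by positivity
  have h' : 2 ^ ∑ q ∈ (NumberField.discr K).natAbs.primeFactors,
      ((if jacobiSym W.Δ.num q = -1 then 1 else 0) +
        (if jacobiSym W.Δ.num q = 1 ∧ Even (W.frobeniusTrace q) then 2 else 0)) ≤ 2 ^ 1 := by
    rw [pow_one]; exact Nat.le_of_mul_le_mul_left hle h2
  exact (Nat.pow_le_pow_iff_right (by norm_num)).mp h'

end Summit.BirchSwinnertonDyer.BirchSwinnertonDyer.Theorems.KolyvaginGenusTwo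

end
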